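/-
Copyright (c) 2026. All rights reserved.
Released under Apache 2.0 license as described in the file LICENSE.
Authors: abc-iut cell, prover seat abc-iut-w5-d017 (wave 5, gen 6).
-/
import Literature.IUT.LogVolume.UnitLogWildDyadicEmpty
import HarnessLib

/-!
# When is the `2`-adic logarithm of a unit a unit? The power criterion (residue field `𝔽₂`)

Proof-only sequel (theorems, no definitions) of `UnitLogRamificationCriterion.lean` (odd `p`: `log_p(𝒪_K^×)`
meets `𝒪_K^×` iff `p ∣ e`), `UnitLogWildDyadicInhabited.lean` (`p = 2`, `2 ∣ e`, `f ≥ 2`: it does) and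
`UnitLogWildDyadicEmpty.lean` (`p = 2`, `f = 1`, `e ≡ 2 (mod 4)`: it does not), settling the SHAPE of the
remaining dyadic case `f = 1`, `4 ∣ e` by an ELEMENTARY CRITERION in terms of `2`-power maps:
* `norm_one_sub_sq_of_lt` / `norm_one_sub_pow_two_pow` — below level `e` squaring DOUBLES the level
  (`1 + y = 2 − (1 − y)`), iterated while `2^n s < 2e`; `norm_logSeries_of_deep` — the isometry range
  `‖1 − w‖ = ‖ϖ‖^a`, `a ≥ e + 1` ⇒ `‖L(w)‖ = ‖ϖ‖^a`; `norm_logSeries_pow_two_pow` — `‖L(y^{2^n})‖ = ‖ϖ‖^{ne}‖L(y)‖`;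
* **`norm_logSeries_eq_one_of_pow`** (sufficiency, any residue degree): `2^k s = e`, `‖1 − y‖ = ‖ϖ‖^s`,
  `‖1 + y^{2^k}‖ = ‖ϖ‖^{ke}` ⇒ `‖L(y)‖ = 1` (`‖1 − y^{2^{k+1}}‖ = ‖ϖ‖^{(k+1)e}` is in the isometry range);
* **`exists_pow_of_norm_logSeries_eq_one`** (necessity, every unit principal, e.g. `f = 1`): `‖L(y)‖ = 1` ⇒
  such `k, s` exist AND `k ≥ 2`: the levels `v(1 − y^{2^n}) = 2^n s` double while `< e`; a JUMP over `e`
  (`e < 2^n s < 2e`) gives `‖L(y)‖ = ‖ϖ‖^{2^n s − ne} ≠ 1` as `ne ∉ (e, 2e)`; LANDING on `e` at step `n` gives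
  `‖L(y)‖ = ‖ϖ‖^{t − ne}`, `t = v(1 + y^{2^n}) ≥ e + 1` since `(1 − y^{2^n})/2 ≡ 1 (mod 𝔪)`, so `n ≥ 2`;
* **`exists_norm_unitLog_eq_one_iff_pow`** — `f(K/ℚ₂) = 1`: `∃ u, ‖log₂ u‖ = 1` iff `∃ k ≥ 2, s ≥ 1`,
  `2^k s = e`, `∃ y`, `‖1 − y‖ = ‖ϖ‖^s`, `‖1 + y^{2^k}‖ = ‖ϖ‖^{ke}` ("`−1` is a `2^k`-th power to precision
  exactly `4^k`"); **`norm_unitLog_ne_one_of_not_four_dvd`** — COROLLARY `f = 1`, `4 ∤ e` ⇒ `‖log₂ u‖ ≠ 1`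
  for all `u` (one proof for p432860's odd `e` at `p = 2` and p433959's `e ≡ 2 (mod 4)`), census forms.

The case `f = 1`, `4 ∣ e` itself is FIELD-DEPENDENT (sequel: `π⁴ + 2π² + 6 = 0` gives `‖log₂(1+π)‖ = 1` via
`k = 2`, `(1+π)⁴ + 1 = 4(π³ + π² + π − 1)`; `ℚ₂(2^{1/4})` gives none; `√−1 ∈ K`, `8 ∤ e` gives none).
Classical (Neukirch, *Algebraic Number Theory* II (5.5)).  Nothing here is disputed mathematics; no IUT
statement is asserted; nothing bears on [IUTchIII] Cor. 3.12.
-/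

noncomputable section

open Metric Set

namespace Literature.IUT.LogVolume

namespace RamificationCriterion

open Literature.NumberTheory.GaloisRepresentations.Ultrametric

variable {K : Type*} [NontriviallyNormedField K] [instK : NormedAlgebra ℚ_[2] K] [IsUltrametricDist K]
  [ProperSpace K]

/-! ### §1. Squaring below and above level `e` -/

/-- `‖2‖ = ‖ϖ‖^e` as an integer power. [cite: NeukirchANT1999, Ch. II (5.5)] -/
theorem norm_two_eq_zpow {ϖ : Kˣ} (hϖ : IsUniformizer ϖ) :
    ‖(2 : K)‖ = ‖(ϖ : K)‖ ^ (absRamificationIdx 2 K : ℤ) := by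
  rw [zpow_natCast]
  exact_mod_cast norm_prime_eq_norm_pow 2 K hϖ

/-- **Squaring below level `e` doubles the level**: `‖1 − y‖ = ‖ϖ‖^s` with `s < e` ⇒ `‖1 − y²‖ = ‖ϖ‖^{2s}`
(`1 + y = 2 − (1 − y)` has norm `‖1 − y‖`). [cite: NeukirchANT1999, Ch. II (5.5)] -/
theorem norm_one_sub_sq_of_lt {ϖ : Kˣ} (hϖ : IsUniformizer ϖ) {y : K} {s : ℤ}
    (hy : ‖1 - y‖ = ‖(ϖ : K)‖ ^ s) (hs : s < (absRamificationIdx 2 K : ℤ)) :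
    ‖1 - y ^ 2‖ = ‖(ϖ : K)‖ ^ (2 * s) := by
  have hρ0 : 0 < ‖(ϖ : K)‖ := norm_units_pos ϖ
  have h2 : ‖(2 : K)‖ < ‖-(1 - y)‖ := by
    rw [norm_neg, hy, norm_two_eq_zpow hϖ]
    exact zpow_lt_zpow_right_of_lt_one₀ hρ0 hϖ.1 hs
  have hplus : ‖1 + y‖ = ‖(ϖ : K)‖ ^ s := by
    rw [show (1 : K) + y = 2 + -(1 - y) by ring,
      IsUltrametricDist.norm_add_eq_max_of_norm_ne_norm (ne_of_lt h2), max_eq_right h2.le, norm_neg, hy]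
  rw [show (1 : K) - y ^ 2 = (1 - y) * (1 + y) by ring, norm_mul, hy, hplus, ← zpow_add₀ hρ0.ne']
  congr 1
  ring

/-- **Squaring above level `e` adds `e`**: `‖1 − y‖ = ‖ϖ‖^s` with `e < s` ⇒ `‖1 − y²‖ = ‖ϖ‖^{s + e}`
(`1 + y = 2 − (1 − y)` has norm `‖2‖`). [cite: NeukirchANT1999, Ch. II (5.5)] -/
theorem norm_one_sub_sq_of_gt {ϖ : Kˣ} (hϖ : IsUniformizer ϖ) {y : K} {s : ℤ}
    (hy : ‖1 - y‖ = ‖(ϖ : K)‖ ^ s) (hs : (absRamificationIdx 2 K : ℤ) < s) :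
    ‖1 - y ^ 2‖ = ‖(ϖ : K)‖ ^ (s + absRamificationIdx 2 K) := by
  have hρ0 : 0 < ‖(ϖ : K)‖ := norm_units_pos ϖ
  have h2 : ‖-(1 - y)‖ < ‖(2 : K)‖ := by
    rw [norm_neg, hy, norm_two_eq_zpow hϖ]
    exact zpow_lt_zpow_right_of_lt_one₀ hρ0 hϖ.1 hs
  have hplus : ‖1 + y‖ = ‖(ϖ : K)‖ ^ (absRamificationIdx 2 K : ℤ) := by
    rw [show (1 : K) + y = 2 + -(1 - y) by ring,
      IsUltrametricDist.norm_add_eq_max_of_norm_ne_norm (ne_of_gt h2), max_eq_left h2.le,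
      norm_two_eq_zpow hϖ]
  rw [show (1 : K) - y ^ 2 = (1 - y) * (1 + y) by ring, norm_mul, hy, hplus, ← zpow_add₀ hρ0.ne']

/-- **Iterated squaring below level `e`**: `‖1 − y‖ = ‖ϖ‖^s`, `2^n s < 2e` ⇒ `‖1 − y^{2^n}‖ = ‖ϖ‖^{2^n s}`
(every intermediate level `2^i s`, `i < n`, is `< e`). [cite: NeukirchANT1999, Ch. II (5.5)] -/
theorem norm_one_sub_pow_two_pow {ϖ : Kˣ} (hϖ : IsUniformizer ϖ) {y : K} {s : ℤ}
    (hy : ‖1 - y‖ = ‖(ϖ : K)‖ ^ s) {n : ℕ} (hn : 2 ^ n * s < 2 * (absRamificationIdx 2 K : ℤ)) :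
    ‖1 - y ^ (2 ^ n)‖ = ‖(ϖ : K)‖ ^ (2 ^ n * s) := by
  induction n with
  | zero => simpa using hy
  | succ n ih =>
    have hn' : 2 ^ n * s < (absRamificationIdx 2 K : ℤ) := by
      rw [pow_succ] at hn
      linarith
    have he : (0 : ℤ) < absRamificationIdx 2 K := by exact_mod_cast absRamificationIdx_pos 2 K
    have h := norm_one_sub_sq_of_lt hϖ (ih (by linarith)) hn'
    rw [← pow_mul, ← pow_succ] at h
    rw [h]
    congr 1
    rw [pow_succ]
    ring

/-! ### §2. The isometry range and the scaling `L(y^{2^n}) = 2^n L(y)` -/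

/-- `v₂(m) < m` for `m ≠ 0`. [folklore] -/
private theorem padicValNat_two_lt {m : ℕ} (hm : m ≠ 0) : padicValNat 2 m < m := by
  have hdvd : 2 ^ padicValNat 2 m ∣ m := pow_padicValNat_dvd
  have hle : 2 ^ padicValNat 2 m ≤ m := Nat.le_of_dvd (Nat.pos_of_ne_zero hm) hdvd
  exact lt_of_lt_of_le (Nat.lt_two_pow_self) hle

/-- **The isometry range**: `‖1 − w‖ = ‖ϖ‖^a`, `a ≥ e + 1` ⇒ `‖L(w)‖ = ‖ϖ‖^a` (index `1` dominates:
`a·m − e·v₂(m) ≥ a + 1` for `m ≥ 2`). [cite: NeukirchANT1999, Ch. II (5.5)] -/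
theorem norm_logSeries_of_deep {ϖ : Kˣ} (hϖ : IsUniformizer ϖ) {w : K} {a : ℤ}
    (hw : ‖1 - w‖ = ‖(ϖ : K)‖ ^ a) (ha : (absRamificationIdx 2 K : ℤ) + 1 ≤ a) :
    ‖logSeries w‖ = ‖(ϖ : K)‖ ^ a := by
  have hρ0 : 0 < ‖(ϖ : K)‖ := norm_units_pos ϖ
  have he : (0 : ℤ) < absRamificationIdx 2 K := by exact_mod_cast absRamificationIdx_pos 2 K
  have hwP : IsPrincipal w := by
    show ‖1 - w‖ < 1
    rw [hw]
    exact zpow_lt_one₀ hρ0 hϖ.1 (by linarith)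
  refine norm_logSeries_eq_zpow_of_dominant 2 hϖ hwP hw 0 (by simp) fun n hn ↦ ?_
  have hv : (padicValNat 2 (n + 1) : ℤ) ≤ n := by
    have := padicValNat_two_lt (m := n + 1) (by omega)
    omega
  have hn1 : (1 : ℤ) ≤ n := by omega
  have hcast : ((n + 1 : ℕ) : ℤ) = (n : ℤ) + 1 := by norm_cast
  rw [hcast]
  nlinarith

/-- `‖2^n‖ = ‖ϖ‖^{ne}`. [cite: NeukirchANT1999, Ch. II (5.5)] -/
theorem norm_two_pow_eq_zpow {ϖ : Kˣ} (hϖ : IsUniformizer ϖ) (n : ℕ) :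
    ‖((2 ^ n : ℕ) : K)‖ = ‖(ϖ : K)‖ ^ ((n : ℤ) * absRamificationIdx 2 K) := by
  rw [Nat.cast_pow, Nat.cast_ofNat, norm_pow, norm_two_eq_zpow hϖ, ← zpow_natCast, ← zpow_mul, mul_comm]

/-- **Scaling**: `‖L(y^{2^n})‖ = ‖ϖ‖^{ne} · ‖L(y)‖` for a principal unit `y` (`L(y^{2^n}) = 2^n L(y)`).
[cite: NeukirchANT1999, Ch. II (5.5)] -/
theorem norm_logSeries_pow_two_pow {ϖ : Kˣ} (hϖ : IsUniformizer ϖ) {y : K} (hyP : IsPrincipal y)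
    (n : ℕ) : ‖logSeries (y ^ (2 ^ n))‖
      = ‖(ϖ : K)‖ ^ ((n : ℤ) * absRamificationIdx 2 K) * ‖logSeries y‖ := by
  rw [logSeries_pow 2 hyP (2 ^ n), norm_mul, norm_two_pow_eq_zpow hϖ]

/-! ### §3. Sufficiency: landing on level `e` with the right `1 + y^{2^k}` -/

/-- **`2^k s = e`, `‖1 − y‖ = ‖ϖ‖^s`, `‖1 + y^{2^k}‖ = ‖ϖ‖^{ke}` ⇒ `‖L(y)‖ = 1`** (any residue degree):
`‖1 − y^{2^{k+1}}‖ = ‖ϖ‖^{e}·‖ϖ‖^{ke}` is in the isometry range (`k = 0` is vacuous: `‖1 + y‖ < 1`).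
[cite: NeukirchANT1999, Ch. II (5.5)] -/
theorem norm_logSeries_eq_one_of_pow {ϖ : Kˣ} (hϖ : IsUniformizer ϖ) {k : ℕ} {s : ℤ}
    (hks : 2 ^ k * s = (absRamificationIdx 2 K : ℤ)) {y : K} (hy : ‖1 - y‖ = ‖(ϖ : K)‖ ^ s)
    (hplus : ‖1 + y ^ (2 ^ k)‖ = ‖(ϖ : K)‖ ^ ((k : ℤ) * absRamificationIdx 2 K)) :
    ‖logSeries y‖ = 1 := by
  have hρ0 : 0 < ‖(ϖ : K)‖ := norm_units_pos ϖ
  set e : ℕ := absRamificationIdx 2 K with he_def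
  have he : (0 : ℤ) < e := by exact_mod_cast absRamificationIdx_pos 2 K
  -- level `e` at step `k`
  have hk : ‖1 - y ^ (2 ^ k)‖ = ‖(ϖ : K)‖ ^ (e : ℤ) := by
    rw [norm_one_sub_pow_two_pow hϖ hy (by rw [hks]; linarith), hks]
  -- `k ≠ 0`
  rcases Nat.eq_zero_or_pos k with hk0 | hk0
  · exfalso
    subst hk0
    rw [pow_zero, pow_one] at hk
    rw [pow_zero, pow_one, Nat.cast_zero, zero_mul, zpow_zero] at hplus
    have h2 : ‖(2 : K)‖ = ‖(ϖ : K)‖ ^ (e : ℤ) := norm_two_eq_zpow hϖ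
    have hlt : ‖(1 : K) + y‖ < 1 := by
      rw [show (1 : K) + y = 2 + -(1 - y) by ring]
      refine (IsUltrametricDist.norm_add_le_max _ _).trans_lt (max_lt ?_ ?_) <;>
        [rw [h2]; rw [norm_neg, hk]] <;> exact zpow_lt_one₀ hρ0 hϖ.1 he
    exact (lt_irrefl (1 : ℝ)) (hplus ▸ hlt)
  have hyP : IsPrincipal y := by
    show ‖1 - y‖ < 1
    rw [hy]
    refine zpow_lt_one₀ hρ0 hϖ.1 ?_
    by_contra hs
    rw [not_lt] at hs
    have : (2 : ℤ) ^ k * s ≤ 0 := mul_nonpos_of_nonneg_of_nonpos (by positivity) hs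
    linarith
  -- level `(k+1)e` at step `k+1`
  have hk1 : ‖1 - y ^ (2 ^ (k + 1))‖ = ‖(ϖ : K)‖ ^ (((k + 1 : ℕ) : ℤ) * e) := by
    rw [pow_succ, pow_mul, show (1 : K) - (y ^ 2 ^ k) ^ 2 = (1 - y ^ 2 ^ k) * (1 + y ^ 2 ^ k) by ring,
      norm_mul, hk, hplus, ← zpow_add₀ hρ0.ne']
    congr 1
    push_cast
    ring
  have hdeep := norm_logSeries_of_deep hϖ hk1 (by push_cast; nlinarith)
  rw [norm_logSeries_pow_two_pow hϖ hyP (k + 1)] at hdeep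
  have hz : ‖(ϖ : K)‖ ^ (((k + 1 : ℕ) : ℤ) * e) ≠ 0 := (zpow_pos hρ0 _).ne'
  calc ‖logSeries y‖ = (‖(ϖ : K)‖ ^ (((k + 1 : ℕ) : ℤ) * e) * ‖logSeries y‖)
        / ‖(ϖ : K)‖ ^ (((k + 1 : ℕ) : ℤ) * e) := by field_simp
    _ = 1 := by rw [hdeep, div_self hz]

/-! ### §4. Necessity when every unit is principal (`f = 1`) -/

/-- The step at which the doubling levels `2^n s` first reach `e`: `e ≤ 2^n s < 2e` (`1 ≤ s ≤ e`).
[folklore] -/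
private theorem exists_two_pow_mul_mem_Ico {s e : ℤ} (hs : 1 ≤ s) (hse : s ≤ e) :
    ∃ n : ℕ, e ≤ 2 ^ n * s ∧ 2 ^ n * s < 2 * e := by
  classical
  have hex : ∃ n : ℕ, e ≤ 2 ^ n * s := by
    refine ⟨e.toNat, ?_⟩
    have h1 : (e.toNat : ℤ) < 2 ^ e.toNat := by exact_mod_cast Nat.lt_two_pow_self
    have h2 : e ≤ (e.toNat : ℤ) := Int.self_le_toNat e
    nlinarith
  refine ⟨Nat.find hex, Nat.find_spec hex, ?_⟩
  rcases Nat.eq_zero_or_pos (Nat.find hex) with h0 | hpos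
  · rw [h0, pow_zero, one_mul]; linarith
  · obtain ⟨m, hm⟩ : ∃ m, Nat.find hex = m + 1 := ⟨Nat.find hex - 1, by omega⟩
    have hmin : ¬ e ≤ 2 ^ m * s := Nat.find_min hex (by omega)
    rw [hm, pow_succ]; linarith

/-- **Necessity (every unit principal, e.g. `f(K/ℚ₂) = 1`)**: if `‖L(y)‖ = 1` for a principal unit `y`,
then `‖1 − y‖ = ‖ϖ‖^s` with `2^k s = e` for some `k ≥ 2`, and `‖1 + y^{2^k}‖ = ‖ϖ‖^{ke}` (doubling levels;
a jump over `e` gives `‖L(y)‖ = ‖ϖ‖^{2^n s − ne} ≠ 1`; landing on `e` forces `v(1 + y^{2^n}) = ne ≥ e + 1`).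
[cite: NeukirchANT1999, Ch. II (5.5)] -/
theorem exists_pow_of_norm_logSeries_eq_one {ϖ : Kˣ} (hϖ : IsUniformizer ϖ)
    (hprinc : ∀ u : K, ‖u‖ = 1 → IsPrincipal u) {y : K} (hyP : IsPrincipal y)
    (h1 : ‖logSeries y‖ = 1) :
    ∃ k : ℕ, 2 ≤ k ∧ ∃ s : ℤ, 1 ≤ s ∧ 2 ^ k * s = (absRamificationIdx 2 K : ℤ) ∧
      ‖1 - y‖ = ‖(ϖ : K)‖ ^ s ∧
      ‖1 + y ^ (2 ^ k)‖ = ‖(ϖ : K)‖ ^ ((k : ℤ) * absRamificationIdx 2 K) := by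
  classical
  have hρ0 : 0 < ‖(ϖ : K)‖ := norm_units_pos ϖ
  set e : ℕ := absRamificationIdx 2 K with he_def
  have he : (0 : ℤ) < e := by exact_mod_cast absRamificationIdx_pos 2 K
  have hinj : ∀ {m n : ℤ}, ‖(ϖ : K)‖ ^ m = ‖(ϖ : K)‖ ^ n → m = n :=
    fun h ↦ zpow_right_injective₀ hρ0 hϖ.1.ne h
  -- `y ≠ 1` and its level `s ≥ 1`
  have hx : 1 - y ≠ 0 := by
    intro hx
    rw [(sub_eq_zero.mp hx).symm, logSeries_one, norm_zero] at h1
    exact zero_ne_one h1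
  obtain ⟨s, hs⟩ := hϖ.2 (Units.mk0 (1 - y) hx)
  rw [Units.val_mk0] at hs
  have hs1 : 1 ≤ s := by
    have hlt : ‖(ϖ : K)‖ ^ s < 1 := by have h := hyP; rw [isPrincipal_iff, hs] at h; exact h
    have h := (zpow_lt_one_iff_right_of_lt_one₀ hρ0 hϖ.1).mp hlt
    omega
  -- `s ≤ e`: otherwise `y` is in the isometry range and `‖L(y)‖ = ‖ϖ‖^s < 1`
  have hse : s ≤ e := by
    by_contra hlt
    rw [not_le] at hlt
    have hdeep := norm_logSeries_of_deep hϖ hs (by omega)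
    rw [h1] at hdeep
    have h0s : (0 : ℤ) = s := hinj (by rw [zpow_zero]; exact hdeep)
    omega
  obtain ⟨n, hn1, hn2⟩ := exists_two_pow_mul_mem_Ico hs1 hse
  have hlev : ‖1 - y ^ (2 ^ n)‖ = ‖(ϖ : K)‖ ^ (2 ^ n * s) := norm_one_sub_pow_two_pow hϖ hs hn2
  have hscale := norm_logSeries_pow_two_pow hϖ hyP n
  rw [h1, mul_one] at hscale
  rcases hn1.lt_or_eq with hjump | hland
  · -- JUMP over `e`
    exfalso
    have hdeep := norm_logSeries_of_deep hϖ hlev (by omega)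
    rw [hscale] at hdeep
    have heq : (n : ℤ) * e = 2 ^ n * s := hinj hdeep
    have hn_gt : (1 : ℤ) < n := by nlinarith
    have hn_lt : (n : ℤ) < 2 := by nlinarith
    omega
  · -- LAND on `e` at step `n`
    set w : K := y ^ (2 ^ n) with hw_def
    have hw : ‖1 - w‖ = ‖(ϖ : K)‖ ^ (e : ℤ) := by rw [hlev, ← hland]
    have h2 : ‖(2 : K)‖ = ‖(ϖ : K)‖ ^ (e : ℤ) := norm_two_eq_zpow hϖ
    have h20 : (2 : K) ≠ 0 := by
      intro h; rw [h, norm_zero] at h2; exact (zpow_pos hρ0 _).ne h2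
    -- `(1 - w)/2` is a unit, hence principal: `‖1 + w‖ < ‖2‖`
    have hunit : ‖(1 - w) / 2‖ = 1 := by rw [norm_div, hw, h2, div_self (zpow_pos hρ0 _).ne']
    have hplt : ‖1 + w‖ < ‖(ϖ : K)‖ ^ (e : ℤ) := by
      have hp : ‖1 - (1 - w) / 2‖ < 1 := hprinc _ hunit
      have h12 : (1 : K) + w = 2 * (1 - (1 - w) / 2) := by field_simp; ring
      rw [h12, norm_mul, h2]
      calc ‖(ϖ : K)‖ ^ (e : ℤ) * ‖1 - (1 - w) / 2‖ < ‖(ϖ : K)‖ ^ (e : ℤ) * 1 :=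
            mul_lt_mul_of_pos_left hp (zpow_pos hρ0 _)
        _ = ‖(ϖ : K)‖ ^ (e : ℤ) := mul_one _
    -- `1 + w ≠ 0`: else `y^{2^{n+1}} = 1` and `L(y) = 0`
    have hw0 : 1 + w ≠ 0 := by
      intro h0
      have hw1 : w = -1 := by linear_combination h0
      have hsq : y ^ (2 ^ (n + 1)) = 1 := by
        rw [pow_succ, pow_mul, ← hw_def, hw1]; norm_num
      have h := norm_logSeries_pow_two_pow hϖ hyP (n + 1)
      rw [hsq, logSeries_one, norm_zero, h1, mul_one] at h
      exact (zpow_pos hρ0 _).ne' h.symm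
    obtain ⟨t, ht⟩ := hϖ.2 (Units.mk0 (1 + w) hw0)
    rw [Units.val_mk0] at ht
    have hte : (e : ℤ) + 1 ≤ t := by
      have := (zpow_lt_zpow_iff_right_of_lt_one₀ hρ0 hϖ.1).mp (ht ▸ hplt)
      omega
    -- level `e + t` at step `n + 1` is in the isometry range
    have hlev1 : ‖1 - y ^ (2 ^ (n + 1))‖ = ‖(ϖ : K)‖ ^ ((e : ℤ) + t) := by
      rw [pow_succ, pow_mul, ← hw_def, show (1 : K) - w ^ 2 = (1 - w) * (1 + w) by ring, norm_mul, hw,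
        ht, ← zpow_add₀ hρ0.ne']
    have hdeep := norm_logSeries_of_deep hϖ hlev1 (by omega)
    have hscale1 := norm_logSeries_pow_two_pow hϖ hyP (n + 1)
    rw [h1, mul_one, hdeep] at hscale1
    have heq : (e : ℤ) + t = ((n + 1 : ℕ) : ℤ) * e := hinj hscale1
    push_cast at heq
    have htn : t = n * e := by linarith
    have hn2' : 2 ≤ n := by
      by_contra hlt
      have hn01 : (n : ℤ) ≤ 1 := by omega
      have : t ≤ e := by rw [htn]; nlinarith
      omega
    refine ⟨n, hn2', s, hs1, hland.symm, hs, ?_⟩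
    rw [← htn]
    exact ht

/-- **`f(K/ℚ₂) = 1` version of necessity** (every unit is principal when the residue field is `𝔽₂`).
[cite: NeukirchANT1999, Ch. II (5.5)] -/
theorem exists_pow_of_norm_logSeries_eq_one_of_residueDegree_eq_one {ϖ : Kˣ} (hϖ : IsUniformizer ϖ)
    (hf : residueDegree 2 K = 1) {y : K} (hyP : IsPrincipal y) (h1 : ‖logSeries y‖ = 1) :
    ∃ k : ℕ, 2 ≤ k ∧ ∃ s : ℤ, 1 ≤ s ∧ 2 ^ k * s = (absRamificationIdx 2 K : ℤ) ∧
      ‖1 - y‖ = ‖(ϖ : K)‖ ^ s ∧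
      ‖1 + y ^ (2 ^ k)‖ = ‖(ϖ : K)‖ ^ ((k : ℤ) * absRamificationIdx 2 K) :=
  exists_pow_of_norm_logSeries_eq_one hϖ
    (fun _ hu ↦ WildDyadic.isPrincipal_of_residueDegree_eq_one hf hu) hyP h1

/-! ### §5. The criterion on units, and the corollary `4 ∤ e` -/

/-- **THE POWER CRITERION (`f(K/ℚ₂) = 1`)**: some unit of `𝒪_K` has a unit `2`-adic logarithm iff for
some `k ≥ 2` with `2^k s = e` (`s ≥ 1`) there is `y` with `‖1 − y‖ = ‖ϖ‖^s` and `‖1 + y^{2^k}‖ = ‖ϖ‖^{ke}`.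
[cite: NeukirchANT1999, Ch. II (5.5)] -/
theorem exists_norm_unitLog_eq_one_iff_pow {ϖ : Kˣ} (hϖ : IsUniformizer ϖ) (hf : residueDegree 2 K = 1) :
    (∃ u : K, ‖u‖ = 1 ∧ ‖unitLog u‖ = 1) ↔
      ∃ k : ℕ, 2 ≤ k ∧ ∃ s : ℤ, 1 ≤ s ∧ 2 ^ k * s = (absRamificationIdx 2 K : ℤ) ∧
        ∃ y : K, ‖1 - y‖ = ‖(ϖ : K)‖ ^ s ∧
          ‖1 + y ^ (2 ^ k)‖ = ‖(ϖ : K)‖ ^ ((k : ℤ) * absRamificationIdx 2 K) := by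
  constructor
  · rintro ⟨u, hu, hlog⟩
    obtain ⟨m, hm0, hmp, hmP⟩ := exists_pow_isPrincipal_not_dvd (p := 2) hu
    have h1 : ‖logSeries (u ^ m)‖ = 1 := by
      rw [unitLog_eq_inv_mul_logSeries 2 hm0 hmP, norm_mul, norm_inv,
        norm_natCast_eq_one_of_not_dvd 2 hmp, inv_one, one_mul] at hlog
      exact hlog
    obtain ⟨k, hk, s, hs1, hks, hy, hplus⟩ :=
      exists_pow_of_norm_logSeries_eq_one_of_residueDegree_eq_one hϖ hf hmP h1
    exact ⟨k, hk, s, hs1, hks, u ^ m, hy, hplus⟩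
  · rintro ⟨k, -, s, hs1, hks, y, hy, hplus⟩
    have hρ0 : 0 < ‖(ϖ : K)‖ := norm_units_pos ϖ
    have hyP : IsPrincipal y := by
      show ‖1 - y‖ < 1
      rw [hy]
      exact zpow_lt_one₀ hρ0 hϖ.1 (by omega)
    refine ⟨y, hyP.norm_eq_one, ?_⟩
    rw [unitLog_of_isPrincipal 2 hyP]
    exact norm_logSeries_eq_one_of_pow hϖ hks hy hplus

/-- **Every unit principal and `4 ∤ e` ⇒ `‖L(y)‖ ≠ 1`** (`2^k ∣ e` with `k ≥ 2` is impossible).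
[cite: NeukirchANT1999, Ch. II (5.5)] -/
theorem norm_logSeries_ne_one_of_not_four_dvd (hprinc : ∀ u : K, ‖u‖ = 1 → IsPrincipal u)
    (h4 : ¬ 4 ∣ absRamificationIdx 2 K) {y : K} (hyP : IsPrincipal y) : ‖logSeries y‖ ≠ 1 := by
  intro h1
  obtain ⟨ϖ, hϖ⟩ := exists_isUniformizer (F := K)
  obtain ⟨k, hk, s, hs1, hks, -, -⟩ := exists_pow_of_norm_logSeries_eq_one hϖ hprinc hyP h1
  apply h4
  obtain ⟨j, rfl⟩ := Nat.exists_eq_add_of_le hk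
  refine ⟨(2 ^ j * s).toNat, ?_⟩
  have hs0 : (0 : ℤ) ≤ 2 ^ j * s := by positivity
  zify
  rw [Int.toNat_of_nonneg hs0, ← hks, pow_add]
  ring

/-- **`f(K/ℚ₂) = 1`, `4 ∤ e(K/ℚ₂)` ⇒ `‖log₂ u‖ ≠ 1` for every `u : K`** — ONE proof for `e` odd and
`e ≡ 2 (mod 4)` (units reduce to principal units by an odd power, `‖m⁻¹‖ = 1`).
[cite: NeukirchANT1999, Ch. II (5.5)] -/
theorem norm_unitLog_ne_one_of_not_four_dvd (hf : residueDegree 2 K = 1)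
    (h4 : ¬ 4 ∣ absRamificationIdx 2 K) (u : K) : ‖unitLog u‖ ≠ 1 := by
  by_cases hu : ‖u‖ = 1
  · obtain ⟨m, hm0, hmp, hmP⟩ := exists_pow_isPrincipal_not_dvd (p := 2) hu
    rw [unitLog_eq_inv_mul_logSeries 2 hm0 hmP, norm_mul, norm_inv,
      norm_natCast_eq_one_of_not_dvd 2 hmp, inv_one, one_mul]
    exact norm_logSeries_ne_one_of_not_four_dvd
      (fun _ hv ↦ WildDyadic.isPrincipal_of_residueDegree_eq_one hf hv) h4 hmP
  · rw [unitLog_of_norm_ne_one hu, norm_zero]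
    exact zero_ne_one

/-- **`f = 1`, `4 ∤ e` ⇒ `log₂(𝒪_K^×)` misses the unit sphere.** [cite: NeukirchANT1999, Ch. II (5.5)] -/
theorem logUnits_inter_sphere_eq_empty_of_not_four_dvd (hf : residueDegree 2 K = 1)
    (h4 : ¬ 4 ∣ absRamificationIdx 2 K) : logUnits K ∩ sphere 0 1 = ∅ := by
  ext z
  simp only [mem_inter_iff, mem_sphere_zero_iff_norm, mem_empty_iff_false, iff_false, not_and]
  rintro ⟨u, -, rfl⟩
  exact norm_unitLog_ne_one_of_not_four_dvd hf h4 u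

/-- … so the "second iterate" of `log₂` on units has EMPTY domain there.
[cite: NeukirchANT1999, Ch. II (5.5)] -/
theorem unitLog_image_logUnits_inter_sphere_eq_empty_of_not_four_dvd (hf : residueDegree 2 K = 1)
    (h4 : ¬ 4 ∣ absRamificationIdx 2 K) : unitLog '' (logUnits K ∩ sphere 0 1) = ∅ := by
  rw [logUnits_inter_sphere_eq_empty_of_not_four_dvd hf h4, image_empty]

end RamificationCriterion

end Literature.IUT.LogVolume

end
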